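import Mathlib
import Literature.Analysis.FunctionSpaces.SobolevDomain
import Literature.Analysis.FluidPDE.BiotSavartCurlPair
import HarnessLib

/-!
# Energy saturation on rung C1 of the crux `EulerZoomLiouville.PowerGaugeEulerLiouville`, I:
# calculus of the rescaled cut-off and of the cut-off profile energy
# (crux = stmt-NavierStokesRegularity-19832, route №10 `EulerZoomLiouville`, line `birth`)

Seat `ns-ezl-19832-w2` (stub-worker under the crux lead `ns-ezl-19832-p1`), cell ns-regularity-ideate.

Let `(V, P)` be the profile of an exactly self-similar member of Seregin's power-gauged ancient
Euler class (`u(t,x) = (−t)^{γ−1} V((−t)^{−γ} x)`, `γ = 1/(2+ρ)`).  The lead's Euler-identity lever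
(`ProfileEnergy.profile_local_energy_equality`, file `…ProfileEnergyEquality`) is the PROFILE LOCAL
ENERGY EQUALITY `(2 − 5γ) ∫ σ|V|² = ∫ (|V|² + 2P) ⟪V, ∇σ⟫ + γ ∫ |V|² ⟪y, ∇σ⟫` for every test
function `σ`.  The chain `…EnergySaturationCutoff` → `…EnergySaturationIdentity` → (sequels) applies
it to the RESCALED cut-offs `σ_L(y) = σ(L⁻¹ y)` and derives an exact scale ODE for the normalised
cut-off energy `N_σ(L) = L^{2ρ−1} ∫ σ(L⁻¹ y)|V(y)|² dy` — the Chae–Shvydkoy / Bronzi–Shvydkoy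
normalisation `L^{−(N−2α)}`, `N = 3`, `α = 1+ρ`, in which the `A`-gauge of the class reads "`N_σ` is
bounded".  This first file is the calculus:

* `fderiv_comp_inv_smul_apply`, `gradient_comp_inv_smul`, `inner_self_gradient_comp_inv_smul`,
  `isTestFunctionOn_comp_inv_smul` — the rescaled cut-off `σ(L⁻¹·)`: chain rule, gradient
  `L⁻¹∇σ(L⁻¹y)`, the Euler term `⟪y, ∇σ_L(y)⟫ = Dσ(L⁻¹y)[L⁻¹y]`, test-function property;
* `hasDerivAt_comp_inv_smul`, `hasDerivAt_rpow_mul_comp_inv_smul` — scale derivatives at a fixed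
  point, `d/dL σ(L⁻¹y) = −L⁻² Dσ(L⁻¹y)[y]`;
* `hasDerivAt_cutoffEnergy`, `continuousAt_cutoffEnergyDeriv` — **differentiation of the cut-off
  energy under the integral sign**: for `σ ∈ C¹_c` and `V ∈ L²_loc`, `L ↦ ∫ σ(L⁻¹y)|V|²` is `C¹` on
  `(0, ∞)` with derivative `∫ (−L⁻² Dσ(L⁻¹y)[y]) |V(y)|² dy` (dominated convergence on the scale
  window `(L/2, 2L)`, bound `norm_scaleDeriv_le`);
* `fderiv_eq_zero_of_not_mem_shell`, `abs_flux_le` — for a cut-off with `0 ≤ σ ≤ 1`, `σ = 1` on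
  `B̄₁`, `σ = 0` off `B₂` (the tree's `exists_radialCutoff`) the Bernoulli flux
  `F_σ(L) = ∫ (|V|²+2P)⟪V, ∇σ_L⟫` lives on the shell `L ≤ |y| ≤ 2L` and
  `|F_σ(L)| ≤ (M/L) ∫_{L ≤ |y| ≤ 2L} (|V|³ + 2|P||V|)`, `‖Dσ‖ ≤ M`.

WHAT THIS IS NOT: not NS regularity, not the crux, not rung C1 — real-analysis bookkeeping serving the
energy-saturation stratum (Bronzi–Shvydkoy 2015 Thm 1.1 in the weak class); `--supports` stmt-19832.
[folklore]
-/

noncomputable section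

set_option linter.dupNamespace false

open MeasureTheory Set Filter Topology Metric Function TopologicalSpace
open scoped ENNReal NNReal RealInnerProductSpace ContDiff

namespace Summit.NavierStokesRegularity.NavierStokesRegularity.Theorems.PowerGaugeEulerLiouville

open Literature.Analysis Literature.Analysis.FunctionSpaces

namespace EnergySaturation

/-! ## Calculus of the rescaled cut-off `σ_L(y) = σ(L⁻¹ y)` -/

section Cutoff

variable {σ : EuclideanSpace ℝ (Fin 3) → ℝ}

/-- Chain rule for the rescaled cut-off: `D(σ(L⁻¹·))(y)[w] = L⁻¹ Dσ(L⁻¹y)[w]`. [folklore] -/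
theorem fderiv_comp_inv_smul_apply (hσ : Differentiable ℝ σ) (L : ℝ) (y w : EuclideanSpace ℝ (Fin 3)) :
    fderiv ℝ (fun z => σ (L⁻¹ • z)) y w = L⁻¹ * fderiv ℝ σ (L⁻¹ • y) w := by
  have h : HasFDerivAt (fun z : EuclideanSpace ℝ (Fin 3) => L⁻¹ • z)
      (L⁻¹ • ContinuousLinearMap.id ℝ (EuclideanSpace ℝ (Fin 3))) y :=
    (hasFDerivAt_id y).const_smul L⁻¹
  have hc := (hσ (L⁻¹ • y)).hasFDerivAt.comp y h
  rw [show (fun z => σ (L⁻¹ • z)) = σ ∘ fun z : EuclideanSpace ℝ (Fin 3) => L⁻¹ • z from rfl, hc.fderiv]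
  simp [smul_eq_mul]

/-- Gradient of the rescaled cut-off: `∇(σ(L⁻¹·))(y) = L⁻¹ ∇σ(L⁻¹y)`. [folklore] -/
theorem gradient_comp_inv_smul (hσ : Differentiable ℝ σ) (L : ℝ) (y : EuclideanSpace ℝ (Fin 3)) :
    gradient (fun z => σ (L⁻¹ • z)) y = L⁻¹ • gradient σ (L⁻¹ • y) := by
  refine ext_inner_right ℝ fun w => ?_
  rw [FluidPDE.inner_gradient_left, real_inner_smul_left, FluidPDE.inner_gradient_left,
    fderiv_comp_inv_smul_apply hσ]

/-- `⟪y, ∇σ_L(y)⟫ = Dσ(L⁻¹y)[L⁻¹y]`: the Euler-type term of (EE_σ) at scale `L`. [folklore] -/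
theorem inner_self_gradient_comp_inv_smul (hσ : Differentiable ℝ σ) (L : ℝ)
    (y : EuclideanSpace ℝ (Fin 3)) :
    ⟪y, gradient (fun z => σ (L⁻¹ • z)) y⟫ = fderiv ℝ σ (L⁻¹ • y) (L⁻¹ • y) := by
  rw [gradient_comp_inv_smul hσ, real_inner_smul_right, real_inner_comm, FluidPDE.inner_gradient_left,
    map_smul, smul_eq_mul]

/-- The rescaled cut-off `σ(L⁻¹·)` of a test function is a test function (`L ≠ 0`). [folklore] -/
theorem isTestFunctionOn_comp_inv_smul (hσ : IsTestFunctionOn (⊤ : Opens (EuclideanSpace ℝ (Fin 3))) σ)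
    {L : ℝ} (hL : L ≠ 0) :
    IsTestFunctionOn (⊤ : Opens (EuclideanSpace ℝ (Fin 3))) (fun z => σ (L⁻¹ • z)) where
  contDiff := hσ.contDiff.comp (contDiff_const_smul _)
  hasCompactSupport := hσ.hasCompactSupport.comp_smul (inv_ne_zero hL)
  tsupport_subset := fun _ _ => trivial

/-- The scale derivative of the rescaled cut-off at a fixed point:
`d/dL σ(L⁻¹ y) = −L⁻² Dσ(L⁻¹y)[y]` (`L ≠ 0`). [folklore] -/
theorem hasDerivAt_comp_inv_smul (hσ : Differentiable ℝ σ) (y : EuclideanSpace ℝ (Fin 3)) {L : ℝ}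
    (hL : L ≠ 0) :
    HasDerivAt (fun L : ℝ => σ (L⁻¹ • y)) (-(L ^ 2)⁻¹ * fderiv ℝ σ (L⁻¹ • y) y) L := by
  have h1 : HasDerivAt (fun L : ℝ => L⁻¹ • y) ((-(L ^ 2)⁻¹) • y) L := (hasDerivAt_inv hL).smul_const y
  have h2 := (hσ (L⁻¹ • y)).hasFDerivAt.comp_hasDerivAt L h1
  simpa only [Function.comp_def, map_smul, smul_eq_mul] using h2

/-- The scale derivative of the weight `L^{2ρ−1} σ(L⁻¹y)` at a fixed point (`L > 0`):
`d/dL [L^{2ρ−1} σ(L⁻¹ y)] = L^{2ρ−2} ((2ρ−1) σ(L⁻¹y) − Dσ(L⁻¹y)[L⁻¹y])`. [folklore] -/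
theorem hasDerivAt_rpow_mul_comp_inv_smul (hσ : Differentiable ℝ σ) (ρ : ℝ)
    (y : EuclideanSpace ℝ (Fin 3)) {L : ℝ} (hL : 0 < L) :
    HasDerivAt (fun L : ℝ => L ^ (2 * ρ - 1) * σ (L⁻¹ • y))
      (L ^ (2 * ρ - 2) * ((2 * ρ - 1) * σ (L⁻¹ • y) - fderiv ℝ σ (L⁻¹ • y) (L⁻¹ • y))) L := by
  have h1 : HasDerivAt (fun L : ℝ => L ^ (2 * ρ - 1)) ((2 * ρ - 1) * L ^ (2 * ρ - 1 - 1)) L :=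
    Real.hasDerivAt_rpow_const (Or.inl hL.ne')
  have h2 : HasDerivAt (fun L : ℝ => L ^ (2 * ρ - 1) * σ (L⁻¹ • y))
      ((2 * ρ - 1) * L ^ (2 * ρ - 1 - 1) * σ (L⁻¹ • y) +
        L ^ (2 * ρ - 1) * (-(L ^ 2)⁻¹ * fderiv ℝ σ (L⁻¹ • y) y)) L :=
    h1.mul (hasDerivAt_comp_inv_smul hσ y hL.ne')
  refine h2.congr_deriv ?_
  have e1 : L ^ (2 * ρ - 1 - 1) = L ^ (2 * ρ - 2) := by
    congr 1; ring
  have e2 : L ^ (2 * ρ - 1) = L ^ (2 * ρ - 2) * L := by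
    rw [show 2 * ρ - 1 = (2 * ρ - 2) + 1 by ring, Real.rpow_add hL, Real.rpow_one]
  rw [e1, e2, map_smul, smul_eq_mul]
  field_simp
  ring

end Cutoff

/-! ## Differentiating the cut-off energy under the integral sign -/

section CutoffEnergy

variable {σ : EuclideanSpace ℝ (Fin 3) → ℝ} {V : EuclideanSpace ℝ (Fin 3) → EuclideanSpace ℝ (Fin 3)}

/-- A uniform bound for the scale derivative `−x⁻² Dσ(x⁻¹y)[y]` of the rescaled cut-off over the
scale window `x ∈ (L/2, 2L)`: it vanishes for `|y| > 2 R L` (`supp σ ⊆ B̄_R`) and is bounded by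
`(L/2)⁻² · M · (2RL)` there (`‖Dσ‖ ≤ M`). [folklore] -/
theorem norm_scaleDeriv_le {R M : ℝ} (hR : 0 ≤ R)
    (hσR : ∀ z, R < ‖z‖ → σ z = 0) (hM : ∀ z, ‖fderiv ℝ σ z‖ ≤ M) {L : ℝ} (hL : 0 < L)
    {x : ℝ} (hx : x ∈ Ioo (L / 2) (2 * L)) (y : EuclideanSpace ℝ (Fin 3)) :
    ‖-(x ^ 2)⁻¹ * fderiv ℝ σ (x⁻¹ • y) y‖ ≤
      (closedBall (0 : EuclideanSpace ℝ (Fin 3)) (2 * R * L)).indicator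
        (fun _ => ((L / 2) ^ 2)⁻¹ * M * (2 * R * L)) y := by
  have hx0 : 0 < x := lt_trans (by positivity) hx.1
  have hM0 : 0 ≤ M := (norm_nonneg _).trans (hM 0)
  by_cases hy : y ∈ closedBall (0 : EuclideanSpace ℝ (Fin 3)) (2 * R * L)
  · rw [indicator_of_mem hy]
    rw [mem_closedBall, dist_zero_right] at hy
    calc ‖-(x ^ 2)⁻¹ * fderiv ℝ σ (x⁻¹ • y) y‖
        = (x ^ 2)⁻¹ * ‖fderiv ℝ σ (x⁻¹ • y) y‖ := by
          rw [norm_mul, norm_neg, norm_inv, norm_pow, Real.norm_of_nonneg hx0.le]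
      _ ≤ (x ^ 2)⁻¹ * (M * ‖y‖) := by
          gcongr
          exact (ContinuousLinearMap.le_opNorm _ _).trans (by gcongr; exact hM _)
      _ ≤ ((L / 2) ^ 2)⁻¹ * (M * (2 * R * L)) := by
          gcongr
          exact hx.1.le
      _ = ((L / 2) ^ 2)⁻¹ * M * (2 * R * L) := by ring
  · rw [indicator_of_notMem hy]
    rw [mem_closedBall, dist_zero_right, not_le] at hy
    -- `|x⁻¹ y| > R`, so `Dσ(x⁻¹ y) = 0`
    have hfar : R < ‖x⁻¹ • y‖ := by
      rw [norm_smul, norm_inv, Real.norm_of_nonneg hx0.le]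
      rw [lt_inv_mul_iff₀ hx0]
      calc x * R ≤ 2 * L * R := by gcongr; exact hx.2.le
        _ = 2 * R * L := by ring
        _ < ‖y‖ := hy
    have hzero : fderiv ℝ σ (x⁻¹ • y) = 0 := by
      have hopen : IsOpen {z : EuclideanSpace ℝ (Fin 3) | R < ‖z‖} := isOpen_lt continuous_const continuous_norm
      have hev : σ =ᶠ[𝓝 (x⁻¹ • y)] fun _ => (0 : ℝ) :=
        eventuallyEq_of_mem (hopen.mem_nhds hfar) fun z hz => hσR z hz
      rw [hev.fderiv_eq, fderiv_const_apply]
    simp [hzero]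

/-- **Differentiation of the cut-off energy under the integral sign.**  For `σ ∈ C¹_c` and
`V ∈ L²_loc`, the cut-off energy `L ↦ ∫ σ(L⁻¹ y) |V(y)|² dy` is differentiable at every `L > 0`
with derivative `∫ (−L⁻² Dσ(L⁻¹y)[y]) |V(y)|² dy`, and the derivative integrand is integrable.
[folklore] -/
theorem hasDerivAt_cutoffEnergy (hσ : ContDiff ℝ 1 σ) (hσc : HasCompactSupport σ)
    (hVm : AEStronglyMeasurable V volume)
    (hV2 : LocallyIntegrable (fun y => ‖V y‖ ^ 2) volume) {L : ℝ} (hL : 0 < L) :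
    Integrable (fun y => (-(L ^ 2)⁻¹ * fderiv ℝ σ (L⁻¹ • y) y) * ‖V y‖ ^ 2) volume ∧
    HasDerivAt (fun L : ℝ => ∫ y, σ (L⁻¹ • y) * ‖V y‖ ^ 2)
      (∫ y, (-(L ^ 2)⁻¹ * fderiv ℝ σ (L⁻¹ • y) y) * ‖V y‖ ^ 2) L := by
  -- constants: support radius and derivative bound of `σ`
  obtain ⟨R₀, hR₀⟩ := hσc.isCompact.isBounded.subset_closedBall (0 : EuclideanSpace ℝ (Fin 3))
  set R : ℝ := max R₀ 0 with hRdef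
  have hR : 0 ≤ R := le_max_right _ _
  have hσR : ∀ z, R < ‖z‖ → σ z = 0 := by
    intro z hz
    refine image_eq_zero_of_notMem_tsupport fun h => ?_
    have := hR₀ h
    rw [mem_closedBall, dist_zero_right] at this
    exact not_lt.2 (this.trans (le_max_left _ _)) hz
  have hσd : Differentiable ℝ σ := hσ.differentiable one_ne_zero
  have hDσc : Continuous (fderiv ℝ σ) := hσ.continuous_fderiv one_ne_zero
  obtain ⟨M, hM⟩ := hDσc.bounded_above_of_compact_support (hσc.fderiv (𝕜 := ℝ))
  have hM0 : 0 ≤ M := (norm_nonneg _).trans (hM 0)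
  -- the data of the dominated-differentiation lemma
  set s : Set ℝ := Ioo (L / 2) (2 * L) with hs
  have hsL : s ∈ 𝓝 L := Ioo_mem_nhds (by linarith) (by linarith)
  set bound : EuclideanSpace ℝ (Fin 3) → ℝ :=
    fun y => (closedBall (0 : EuclideanSpace ℝ (Fin 3)) (2 * R * L)).indicator
      (fun _ => ((L / 2) ^ 2)⁻¹ * M * (2 * R * L)) y * ‖V y‖ ^ 2 with hbound
  -- measurability of the integrands
  have hmeas : ∀ x : ℝ, AEStronglyMeasurable (fun y => σ (x⁻¹ • y) * ‖V y‖ ^ 2) volume := fun x =>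
    ((hσ.continuous.comp (continuous_const_smul _)).aestronglyMeasurable).mul (hVm.norm.pow 2)
  have hmeas' : ∀ x : ℝ, AEStronglyMeasurable
      (fun y => (-(x ^ 2)⁻¹ * fderiv ℝ σ (x⁻¹ • y) y) * ‖V y‖ ^ 2) volume := by
    intro x
    refine AEStronglyMeasurable.mul ?_ (hVm.norm.pow 2)
    refine (Continuous.aestronglyMeasurable ?_)
    exact continuous_const.mul ((hDσc.comp (continuous_const_smul _)).clm_apply continuous_id)
  -- integrability at `L`
  have hint : Integrable (fun y => σ (L⁻¹ • y) * ‖V y‖ ^ 2) volume := by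
    have hcont : Continuous (fun y : EuclideanSpace ℝ (Fin 3) => σ (L⁻¹ • y)) :=
      hσ.continuous.comp (continuous_const_smul _)
    have := hV2.integrable_smul_left_of_hasCompactSupport hcont (hσc.comp_smul (inv_ne_zero hL.ne'))
    simpa only [smul_eq_mul] using this
  -- the bound is integrable
  have hbound_int : Integrable bound volume := by
    have h1 : IntegrableOn (fun y => ‖V y‖ ^ 2) (closedBall (0 : EuclideanSpace ℝ (Fin 3)) (2 * R * L)) volume :=
      hV2.integrableOn_isCompact (isCompact_closedBall _ _)
    have h2 := (h1.integrable_indicator measurableSet_closedBall).const_mul (((L / 2) ^ 2)⁻¹ * M * (2 * R * L))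
    refine h2.congr (Eventually.of_forall fun y => ?_)
    simp only [hbound]
    by_cases hy : y ∈ closedBall (0 : EuclideanSpace ℝ (Fin 3)) (2 * R * L)
    · simp [indicator_of_mem hy]
    · simp [indicator_of_notMem hy]
  -- domination of the derivative on the scale window
  have hdom : ∀ᵐ y ∂(volume : Measure (EuclideanSpace ℝ (Fin 3))), ∀ x ∈ s,
      ‖(-(x ^ 2)⁻¹ * fderiv ℝ σ (x⁻¹ • y) y) * ‖V y‖ ^ 2‖ ≤ bound y := by
    refine Eventually.of_forall fun y x hx => ?_
    rw [norm_mul]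
    simp only [hbound]
    exact mul_le_mul (norm_scaleDeriv_le hR hσR hM hL hx y) (by rw [Real.norm_of_nonneg (by positivity)])
      (norm_nonneg _) (Set.indicator_nonneg (fun _ _ => by positivity) _)
  -- pointwise differentiability on the window
  have hdiff : ∀ᵐ y ∂(volume : Measure (EuclideanSpace ℝ (Fin 3))), ∀ x ∈ s,
      HasDerivAt (fun x : ℝ => σ (x⁻¹ • y) * ‖V y‖ ^ 2)
        ((-(x ^ 2)⁻¹ * fderiv ℝ σ (x⁻¹ • y) y) * ‖V y‖ ^ 2) x := by
    refine Eventually.of_forall fun y x hx => ?_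
    have hx0 : x ≠ 0 := (lt_trans (by positivity) hx.1).ne'
    exact (hasDerivAt_comp_inv_smul hσd y hx0).mul_const _
  exact hasDerivAt_integral_of_dominated_loc_of_deriv_le hsL (Eventually.of_forall hmeas) hint
    (hmeas' L) hdom hbound_int hdiff

/-- **Continuity of the scale derivative of the cut-off energy** at every `L > 0` (dominated
convergence on the scale window `(L/2, 2L)` with the bound of `norm_scaleDeriv_le`). [folklore] -/
theorem continuousAt_cutoffEnergyDeriv (hσ : ContDiff ℝ 1 σ) (hσc : HasCompactSupport σ)
    (hVm : AEStronglyMeasurable V volume)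
    (hV2 : LocallyIntegrable (fun y => ‖V y‖ ^ 2) volume) {L : ℝ} (hL : 0 < L) :
    ContinuousAt (fun L : ℝ => ∫ y, (-(L ^ 2)⁻¹ * fderiv ℝ σ (L⁻¹ • y) y) * ‖V y‖ ^ 2) L := by
  obtain ⟨R₀, hR₀⟩ := hσc.isCompact.isBounded.subset_closedBall (0 : EuclideanSpace ℝ (Fin 3))
  set R : ℝ := max R₀ 0 with hRdef
  have hR : 0 ≤ R := le_max_right _ _
  have hσR : ∀ z, R < ‖z‖ → σ z = 0 := by
    intro z hz
    refine image_eq_zero_of_notMem_tsupport fun h => ?_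
    have := hR₀ h
    rw [mem_closedBall, dist_zero_right] at this
    exact not_lt.2 (this.trans (le_max_left _ _)) hz
  have hDσc : Continuous (fderiv ℝ σ) := hσ.continuous_fderiv one_ne_zero
  obtain ⟨M, hM⟩ := hDσc.bounded_above_of_compact_support (hσc.fderiv (𝕜 := ℝ))
  have hM0 : 0 ≤ M := (norm_nonneg _).trans (hM 0)
  set s : Set ℝ := Ioo (L / 2) (2 * L) with hs
  have hsL : s ∈ 𝓝 L := Ioo_mem_nhds (by linarith) (by linarith)
  set bound : EuclideanSpace ℝ (Fin 3) → ℝ :=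
    fun y => (closedBall (0 : EuclideanSpace ℝ (Fin 3)) (2 * R * L)).indicator
      (fun _ => ((L / 2) ^ 2)⁻¹ * M * (2 * R * L)) y * ‖V y‖ ^ 2 with hbound
  have hbound_int : Integrable bound volume := by
    have h1 : IntegrableOn (fun y => ‖V y‖ ^ 2) (closedBall (0 : EuclideanSpace ℝ (Fin 3)) (2 * R * L)) volume :=
      hV2.integrableOn_isCompact (isCompact_closedBall _ _)
    have h2 := (h1.integrable_indicator measurableSet_closedBall).const_mul (((L / 2) ^ 2)⁻¹ * M * (2 * R * L))
    refine h2.congr (Eventually.of_forall fun y => ?_)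
    simp only [hbound]
    by_cases hy : y ∈ closedBall (0 : EuclideanSpace ℝ (Fin 3)) (2 * R * L)
    · simp [indicator_of_mem hy]
    · simp [indicator_of_notMem hy]
  refine continuousAt_of_dominated (bound := bound) (Eventually.of_forall fun x => ?_) ?_ hbound_int ?_
  · refine AEStronglyMeasurable.mul ?_ (hVm.norm.pow 2)
    refine (Continuous.aestronglyMeasurable ?_)
    exact continuous_const.mul ((hDσc.comp (continuous_const_smul _)).clm_apply continuous_id)
  · filter_upwards [hsL] with x hx
    refine Eventually.of_forall fun y => ?_
    rw [norm_mul]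
    simp only [hbound]
    exact mul_le_mul (norm_scaleDeriv_le hR hσR hM hL hx y) (by rw [Real.norm_of_nonneg (by positivity)])
      (norm_nonneg _) (Set.indicator_nonneg (fun _ _ => by positivity) _)
  · refine Eventually.of_forall fun y => ?_
    refine ContinuousAt.mul ?_ continuousAt_const
    refine ContinuousAt.mul ?_ ?_
    · exact ((continuousAt_id.pow 2).inv₀ (pow_ne_zero 2 hL.ne')).neg
    · have h1 : ContinuousAt (fun x : ℝ => x⁻¹ • y) L :=
        (continuousAt_inv₀ hL.ne').smul continuousAt_const
      exact ((hDσc.continuousAt.comp h1).clm_apply continuousAt_const)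

end CutoffEnergy


/-! ## The flux through a shell cut-off -/

section Flux

variable {σ : EuclideanSpace ℝ (Fin 3) → ℝ}
  {V : EuclideanSpace ℝ (Fin 3) → EuclideanSpace ℝ (Fin 3)} {P : EuclideanSpace ℝ (Fin 3) → ℝ}

/-- A differentiable cut-off with `0 ≤ σ ≤ 1`, `σ = 1` on `B̄₁` and `σ = 0` off `B₂` (the tree's
`exists_radialCutoff`) has `Dσ(z) = 0` unless `1 < |z| < 2` (every point of `B̄₁` is a global
maximum, every point off `B₂` a global minimum: Fermat). [folklore] -/
theorem fderiv_eq_zero_of_not_mem_shell (h0 : ∀ z, 0 ≤ σ z)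
    (h1 : ∀ z, σ z ≤ 1) (hone : ∀ z, ‖z‖ ≤ 1 → σ z = 1) (hzero : ∀ z, 2 ≤ ‖z‖ → σ z = 0)
    {z : EuclideanSpace ℝ (Fin 3)} (hz : ¬ (1 < ‖z‖ ∧ ‖z‖ < 2)) : fderiv ℝ σ z = 0 := by
  by_cases hz1 : ‖z‖ ≤ 1
  · -- global maximum
    have hmax : IsLocalMax σ z :=
      Filter.Eventually.of_forall fun w => by rw [hone z hz1]; exact h1 w
    exact hmax.fderiv_eq_zero
  · have hz2 : 2 ≤ ‖z‖ := by
      by_contra h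
      exact hz ⟨not_le.1 hz1, not_le.1 h⟩
    have hmin : IsLocalMin σ z :=
      Filter.Eventually.of_forall fun w => by rw [hzero z hz2]; exact h0 w
    exact hmin.fderiv_eq_zero

/-- **The flux lives on the shell and is controlled by the cubic and pressure–velocity
densities**: for a cut-off as in `exists_radialCutoff` with `‖Dσ‖ ≤ M`,
`|F_σ(L)| = |∫ (|V|²+2P)⟪V, ∇σ_L⟫| ≤ (M/L) ∫_{L ≤ |y| ≤ 2L} (|V|³ + 2|P||V|)` (`L > 0`). [folklore] -/
theorem abs_flux_le (hσd : Differentiable ℝ σ) (h0 : ∀ z, 0 ≤ σ z)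
    (h1 : ∀ z, σ z ≤ 1) (hone : ∀ z, ‖z‖ ≤ 1 → σ z = 1) (hzero : ∀ z, 2 ≤ ‖z‖ → σ z = 0)
    {M : ℝ} (hM : ∀ z, ‖fderiv ℝ σ z‖ ≤ M)
    (hV3 : LocallyIntegrable (fun y => ‖V y‖ ^ 3) volume)
    (hPV : LocallyIntegrable (fun y => |P y| * ‖V y‖) volume) {L : ℝ} (hL : 0 < L) :
    |∫ x, (‖V x‖ ^ 2 + 2 * P x) * ⟪V x, gradient (fun z => σ (L⁻¹ • z)) x⟫| ≤
      M / L * ∫ y in {y | L ≤ ‖y‖ ∧ ‖y‖ ≤ 2 * L}, (‖V y‖ ^ 3 + 2 * |P y| * ‖V y‖) := by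
  have hM0 : 0 ≤ M := (norm_nonneg _).trans (hM 0)
  set S : Set (EuclideanSpace ℝ (Fin 3)) := {y | L ≤ ‖y‖ ∧ ‖y‖ ≤ 2 * L} with hS
  have hSclosed : IsClosed S :=
    (isClosed_le continuous_const continuous_norm).inter (isClosed_le continuous_norm continuous_const)
  have hSm : MeasurableSet S := hSclosed.measurableSet
  have hSc : IsCompact S := by
    refine (isCompact_closedBall (0 : EuclideanSpace ℝ (Fin 3)) (2 * L)).of_isClosed_subset hSclosed ?_
    intro y hy; rw [mem_closedBall, dist_zero_right]; exact hy.2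
  -- the dominating function
  set g : EuclideanSpace ℝ (Fin 3) → ℝ :=
    S.indicator fun y => M / L * (‖V y‖ ^ 3 + 2 * |P y| * ‖V y‖) with hg
  have hdens : IntegrableOn (fun y => ‖V y‖ ^ 3 + 2 * |P y| * ‖V y‖) S volume := by
    have hV3S : IntegrableOn (fun y => ‖V y‖ ^ 3) S volume := hV3.integrableOn_isCompact hSc
    have hPVS : IntegrableOn (fun y => 2 * |P y| * ‖V y‖) S volume := by
      have h := (hPV.integrableOn_isCompact hSc).const_mul 2
      exact (integrableOn_congr_fun (fun y _ => by ring) hSm).1 h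
    exact hV3S.add hPVS
  have hgi : Integrable g volume := by
    rw [hg, integrable_indicator_iff hSm]
    exact hdens.const_mul (M / L)
  -- pointwise domination
  have hdom : ∀ y, ‖(‖V y‖ ^ 2 + 2 * P y) * ⟪V y, gradient (fun z => σ (L⁻¹ • z)) y⟫‖ ≤ g y := by
    intro y
    rw [real_inner_comm, FluidPDE.inner_gradient_left, fderiv_comp_inv_smul_apply hσd]
    by_cases hy : y ∈ S
    · rw [hg, indicator_of_mem hy]
      rw [Real.norm_eq_abs, abs_mul, abs_mul, abs_inv, abs_of_pos hL]
      have hA : |‖V y‖ ^ 2 + 2 * P y| ≤ ‖V y‖ ^ 2 + 2 * |P y| := by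
        refine (abs_add_le _ _).trans ?_
        rw [abs_of_nonneg (by positivity), abs_mul, abs_two]
      have hB : |fderiv ℝ σ (L⁻¹ • y) (V y)| ≤ M * ‖V y‖ := by
        rw [← Real.norm_eq_abs]
        exact (ContinuousLinearMap.le_opNorm _ _).trans (by gcongr; exact hM _)
      calc |‖V y‖ ^ 2 + 2 * P y| * (L⁻¹ * |fderiv ℝ σ (L⁻¹ • y) (V y)|)
          ≤ (‖V y‖ ^ 2 + 2 * |P y|) * (L⁻¹ * (M * ‖V y‖)) := by gcongr
        _ = M / L * (‖V y‖ ^ 3 + 2 * |P y| * ‖V y‖) := by ring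
    · rw [hg, indicator_of_notMem hy]
      -- off the shell the derivative of the cut-off vanishes
      have hz : ¬ (1 < ‖L⁻¹ • y‖ ∧ ‖L⁻¹ • y‖ < 2) := by
        rw [norm_smul, norm_inv, Real.norm_of_nonneg hL.le]
        rintro ⟨ha, hb⟩
        apply hy
        rw [hS, mem_setOf_eq]
        rw [lt_inv_mul_iff₀ hL] at ha
        rw [inv_mul_lt_iff₀ hL] at hb
        exact ⟨by linarith, by linarith⟩
      rw [fderiv_eq_zero_of_not_mem_shell h0 h1 hone hzero hz]
      simp
  have hle := norm_integral_le_of_norm_le hgi (Eventually.of_forall hdom)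
  rw [Real.norm_eq_abs] at hle
  refine hle.trans (le_of_eq ?_)
  rw [hg, integral_indicator hSm, integral_const_mul]

end Flux

end EnergySaturation

end Summit.NavierStokesRegularity.NavierStokesRegularity.Theorems.PowerGaugeEulerLiouville

end
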